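/-
Copyright (c) 2026 the pub-hodgecm-mathlib formalisation cell (harness21).  Prover seat hodgecm-mathlib-K2E3-p06 (g6) = U1-glob END PEN ∕ U1 desk (W4′) (LEAD F0P6-plan (g15)
BATCH #187 (1)), Track B «K2-LIT» ∕ hLiu418 = stmt-HodgeConjecture-24832: U1-glob LEVEL 2-fin, FILE A brick (RECIPE eb0ff1dc8da31b24 steps 0–1) — THE CORNER DRESS of a rank-one
coefficient, UNIFORM IN `s`, with the corner entry's letters (`σ ≠ 0`, `c σ = −σ`, `gramR 1 1 · Tr(σδ) ≠ 0`) discharged.  THEOREMS ONLY (no `def`∕`instance`∕notation∕`sorry`).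
-/
import Summits.HodgeConjecture.HodgeConjecture.Theorems.K2LiuRankOneCornerIndexTransport      -- ★ (K1a-1) p862643: `exists_rat_levi_blocks_levi_map`, `conj_index_eq_single`, `whittakerDelta_eq_whittakerDelta_conj_index`
import Summits.HodgeConjecture.HodgeConjecture.Theorems.K2LiuKindOneSingularCornerTraceLetter  -- ★ p863609: `complexConj_eq_neg_of_single_mem_skewMatrices`, `cornerTrace_ne_zero`
import Summits.HodgeConjecture.HodgeConjecture.Theorems.K2LiuRankOneTwoByTwo                  -- ★ `exists_vecMulVec_of_det_eq_zero`
import HarnessLib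

/-!
# Crux `HLiu418`, U1-glob LEVEL 2-fin — FILE A brick: THE CORNER DRESS OF A RANK-ONE WHITTAKER COEFFICIENT, UNIFORM IN `s`
# `∃ g σ, σ ≠ 0 ∧ c σ = −σ ∧ t₁·Tr(σδ) ≠ 0 ∧ ∀ s h, W_X(f_s)(h) = W_{σE₁₁}(f_s)(Λĝ · h)`  [KudlaRallis1994 §2 (2.10)–(2.12); MoeglinWaldspurger1995 II.1.7; Shimura1997 §18.4]

Cell `hodgecm-mathlib`, crux item hLiu418 = `stmt-HodgeConjecture-24832`; squad K2, strike line L1; LEAD F0P6-plan (g15); U1 desk ∕ END pen K2E3-p06 (g6).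
Lane `--supports stmt-HodgeConjecture-24832 --as helper` (count-neutral).

THE POINT.  FILE A `K2LiuLocalKernelPlacePackageFinite :: hplace_of_localKernel_finite` (RECIPE eb0ff1dc8da31b24) starts, for each rank-one `T_L`-skew index `X` (`X ≠ 0`, `det X = 0`),
with steps 0–1: `X = u ⊗ w` (★ `exists_vecMulVec_of_det_eq_zero`) and ★ (K1a-1) p862643's corner transport.  ★ (K1a-1) `exists_corner_index_whittakerDelta_eq` is stated for ONE
section `f` at ONE `s` (the corner entry bound under that `s`); LEVEL 2 needs ONE corner entry `σ♭` for the whole FAMILY `s ↦ f s` (the local value `Fn`, the flat local family `bT`, the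
head `HT` are all built at `S♭ = σ♭ E₁₁`).  THIS FILE re-runs (K1a-1)'s three ★ steps with the data-only letters first — `g := γ[w]`, the rational Levi blocks `(ĝ, D₀)` of `Λĝ`
(★ `exists_rat_levi_blocks_levi_map`), the corner law `D₀ X ĝ⁻¹ = σ♭ E₁₁`, `σ♭ ≠ 0` (★ `conj_index_eq_single`) — and only then, for EVERY `s` and `h`, the transport
`W_X(f_s)(h) = W_{σ♭E₁₁}(f_s)(Λĝ·h)` (★ `whittakerDelta_eq_whittakerDelta_conj_index`); and it DISCHARGES the corner entry's letters the local producers ask for: `σ♭ E₁₁` is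
`T_L`-skew (★ `conj_index_mem_skewMatrices`), hence `c σ♭ = −σ♭` (★ `complexConj_eq_neg_of_single_mem_skewMatrices`) and `gramR 1 1 · Tr_{L∕L⁺}(σ♭·δ_L) ≠ 0` (★ `cornerTrace_ne_zero`)
— the `hτ` ∕ `hσ'` of ★ localFace, ★ TailGlue §4–§5, (F-loc), (F-rest).
* **`exists_cornerDress`** — the package above (by-value letters: `(Λ, hΛ)`, the row section `(γ, hγ)`, and `hconj : ∀ g, MeasurePreserving (u ↦ Λĝ u Λĝ⁻¹) νN νN`, as ★ (K1a-1)).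
References: [KudlaRallis1994] S. Kudla, S. Rallis, Ann. of Math. 140 (1994), §2 (2.10)–(2.12); [MoeglinWaldspurger1995] II.1.7; [Shimura1997] §18.3–18.4; [HarrisKudlaSweet1996] §1 (1.11)–(1.12).
HONEST LABEL.  Count-neutral helper (pure composition of ★ lemmas): `HC_CM` is proved only modulo the 7 printed citations (2 remaining named inputs: hLiu418 =
`stmt-HodgeConjecture-24832`, h413 = `stmt-HodgeConjecture-24833`) until rung 0 closes; U1-glob LEVEL 2 stays OPEN (FILE A∕B).
-/

set_option autoImplicit false
set_option linter.dupNamespace false -- the mandated namespace repeats `HodgeConjecture.HodgeConjecture`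

noncomputable section

open scoped Matrix ENNReal NNReal ComplexConjugate
open NumberField IsDedekindDomain MeasureTheory MeasureTheory.Measure Filter Set Function
open Literature.NumberTheory.Automorphic Literature.NumberTheory.Automorphic.UnitaryGroup Literature.NumberTheory.GaloisRepresentations
open Literature.NumberTheory.GelbartRogawski1991 Literature.NumberTheory.GelbartRogawski1991.GRConstruction
open Literature.NumberTheory.GelbartRogawski1991.AdaptedBlocks Literature.NumberTheory.GelbartRogawski1991.UnitaryDualPair
open Literature.NumberTheory.K2Lit.SiegelDoubled Literature.MeasureTheory.Group
open Summit.HodgeConjecture.HodgeConjecture.Cruxes.HLiu418.K2LiuSiegelUnipotentFourierDefs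
open Summit.HodgeConjecture.HodgeConjecture.Cruxes.HLiu418.K2LiuSiegelUnipotentCharacters
open Summit.HodgeConjecture.HodgeConjecture.Cruxes.HLiu418.K2LiuSiegelLeviConjUnipDeltaChar
open Summit.HodgeConjecture.HodgeConjecture.Cruxes.HLiu418.K2LiuSiegelRationalLeviDecomposition
open Summit.HodgeConjecture.HodgeConjecture.Cruxes.HLiu418.K2LiuSiegelMiddleCellLeviCriterion (row_ne_zero)
open Summit.HodgeConjecture.HodgeConjecture.Cruxes.HLiu418.K2LiuRankOneTwoByTwo (exists_vecMulVec_of_det_eq_zero)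
open Summit.HodgeConjecture.HodgeConjecture.Cruxes.HLiu418.K2LiuRankOneCornerIndexTransport
open Summit.HodgeConjecture.HodgeConjecture.Cruxes.HLiu418.K2LiuKindOneSingularCornerTraceLetter (complexConj_eq_neg_of_single_mem_skewMatrices cornerTrace_ne_zero)

namespace Summit.HodgeConjecture.HodgeConjecture.Cruxes.HLiu418.K2LiuLocalKernelCornerDress

variable (L : Type) [Field L] [NumberField L] [IsCMField L] {N M : ℕ} (e : Fin N × Fin M ≃ Fin 2)
  (dV : Fin N → L) (hdV : ∀ i, IsCMField.complexConj L (dV i) = dV i) (hdV0 : ∀ i, dV i ≠ 0)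
  (dW : Fin M → L) (hdW : ∀ i, IsCMField.complexConj L (dW i) = dW i) (hdW0 : ∀ i, dW i ≠ 0)
  [MeasurableSpace (unipDelta L e dV hdV dW hdW)] [BorelSpace (unipDelta L e dV hdV dW hdW)]
  (Λ : GL (Fin 2) (AdeleRing (𝓞 L) L) →* HA L e dV hdV dW hdW)
  (hΛ : ∀ g : GL (Fin 2) (AdeleRing (𝓞 L) L), blk L e dV hdV dW hdW (Λ g) =
    cayR (AdeleRing (𝓞 L) L) (Fin 2) * Matrix.fromBlocks (g : Matrix (Fin 2) (Fin 2) (AdeleRing (𝓞 L) L)) 0 0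
      (((gramR L e dV hdV dW hdW).map ((algebraMap L (AdeleRing (𝓞 L) L)).comp (algebraMap (Fp L) L)))⁻¹ *
        (((g⁻¹ : GL (Fin 2) (AdeleRing (𝓞 L) L)) : Matrix (Fin 2) (Fin 2) (AdeleRing (𝓞 L) L)).map
          (conjAdele (Fp L) L (IsCMField.complexConj L)))ᵀ *
        (gramR L e dV hdV dW hdW).map ((algebraMap L (AdeleRing (𝓞 L) L)).comp (algebraMap (Fp L) L))) *
      cayRinv (AdeleRing (𝓞 L) L) (Fin 2))

include hΛ hdV0 hdW0 in
/-- **THE CORNER DRESS OF A RANK-ONE COEFFICIENT, UNIFORM IN `s`.**  For a FAMILY of Siegel sections `f s ∈ I_Δ(s, χ)`, a `T_L`-skew rank-one index `X` (`X ≠ 0`, `det X = 0`), a row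
section `γ` of `ℙ¹(L)`, and the `Λĝ`-conjugations preserving `νN` (BY VALUE, as ★ (K1a-1)): there are `g ∈ GL₂(L)` and the corner entry `σ♭ ∈ L` with `σ♭ ≠ 0`, `c σ♭ = −σ♭`,
`gramR 1 1 · Tr_{L∕L⁺}(σ♭·δ_L) ≠ 0`, and for EVERY `s` and `h ∈ H(𝔸)`: `W_X(f_s)(h) = W_{σ♭ E₁₁}(f_s)(Λĝ · h)`.
[cite: KudlaRallis1994, §2 (2.10)–(2.12)] [cite: MoeglinWaldspurger1995, II.1.7] [cite: Shimura1997, §18.4] [cite: HarrisKudlaSweet1996, §1 (1.11)–(1.12)] -/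
theorem exists_cornerDress (νN : Measure (unipDelta L e dV hdV dW hdW)) [νN.IsMulLeftInvariant]
    {χ : HeckeCharacter L} (f : ℂ → HA L e dV hdV dW hdW → ℂ) (hf : ∀ s, IsSiegelDeltaSection L e dV hdV dW hdW χ s (f s))
    {X : Matrix (Fin 2) (Fin 2) L}
    (hX : X ∈ skewMatrices ((IsCMField.complexConj L : L ≃ₐ[Fp L] L) : L →+* L) ((gramR L e dV hdV dW hdW).map (algebraMap (Fp L) L)))
    (hX0 : X ≠ 0) (hXd : X.det = 0)
    (γ : Projectivization L (Fin 2 → L) → GL (Fin 2) L)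
    (hγ : ∀ p, Projectivization.mk L ((γ p : Matrix (Fin 2) (Fin 2) L) 1) (row_ne_zero (γ p) 1) = p)
    (hconj : ∀ g : GL (Fin 2) L, MeasurePreserving (fun v : unipDelta L e dV hdV dW hdW =>
      (⟨Λ (Matrix.GeneralLinearGroup.map (algebraMap L (AdeleRing (𝓞 L) L)) g) * (v : HA L e dV hdV dW hdW) *
          (Λ (Matrix.GeneralLinearGroup.map (algebraMap L (AdeleRing (𝓞 L) L)) g))⁻¹,
        conj_levi_mem_unipDelta L e dV hdV dW hdW Λ hΛ _ v.2⟩ : unipDelta L e dV hdV dW hdW)) νN νN) :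
    ∃ (g : GL (Fin 2) L) (σ : L), σ ≠ 0 ∧ IsCMField.complexConj L σ = -σ ∧
      gramR L e dV hdV dW hdW 1 1 * Algebra.trace (Fp L) L (σ * imagUnit L) ≠ 0 ∧
      ∀ (s : ℂ) (h : HA L e dV hdV dW hdW),
        whittakerDelta L e dV hdV dW hdW νN X (f s) h =
          whittakerDelta L e dV hdV dW hdW νN (Matrix.single 1 1 σ) (f s)
            (Λ (Matrix.GeneralLinearGroup.map (algebraMap L (AdeleRing (𝓞 L) L)) g) * h) := by
  -- step 0: `X = u ⊗ w`
  obtain ⟨u, w, hu, hw, hX1⟩ := exists_vecMulVec_of_det_eq_zero hX0 hXd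
  -- step 1 (data): `g := γ[w]`, the rational Levi blocks of `Λĝ`, the corner law
  obtain ⟨ha, D₀, hd, hrel, hD₀⟩ := exists_rat_levi_blocks_levi_map Λ hΛ hdV0 hdW0 (γ (Projectivization.mk L w hw))
  obtain ⟨hsingle, hσ0⟩ := conj_index_eq_single Λ hΛ hdV0 hdW0 hX hX1 hu hw γ hγ hd hD₀
  -- the corner entry is imaginary: the transported index is `T_L`-skew
  have hskew : Matrix.single (1 : Fin 2) (1 : Fin 2)
      ((D₀ * X * ((γ (Projectivization.mk L w hw) : GL (Fin 2) L) : Matrix (Fin 2) (Fin 2) L)⁻¹) 1 1) ∈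
      skewMatrices ((IsCMField.complexConj L : L ≃ₐ[Fp L] L) : L →+* L) ((gramR L e dV hdV dW hdW).map (algebraMap (Fp L) L)) := by
    rw [← hsingle]
    exact conj_index_mem_skewMatrices L e dV hdV dW hdW hdV0 hdW0 (Matrix.isUnits_det_units _) hrel hX
  have hσc := complexConj_eq_neg_of_single_mem_skewMatrices L e dV hdV hdV0 dW hdW hdW0 hskew
  refine ⟨γ (Projectivization.mk L w hw), _, hσ0, hσc, cornerTrace_ne_zero L e dV hdV hdV0 dW hdW hdW0 hσ0 hσc, fun s h => ?_⟩
  rw [← hsingle]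
  exact whittakerDelta_eq_whittakerDelta_conj_index Λ hΛ hdV0 hdW0 νN (hf s) (γ (Projectivization.mk L w hw)) (hconj _)
    (Matrix.isUnits_det_units _) ha hd X h

end Summit.HodgeConjecture.HodgeConjecture.Cruxes.HLiu418.K2LiuLocalKernelCornerDress

end
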